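import Literature.AlgebraicGeometry.Frobenioids.PadicFrobenioidRmk121
import Literature.AlgebraicGeometry.Frobenioids.PadicFrobenioidQpSplit
import Literature.AlgebraicGeometry.Frobenioids.PadicFrobenioidIsFrobenioid
import Literature.AlgebraicGeometry.Frobenioids.PadicFrobenioidIsotropic
import Literature.AlgebraicGeometry.Frobenioids.PadicFrobenioidPreModel
import Literature.AlgebraicGeometry.Frobenioids.PadicUnitGroupProfinite
import Literature.AlgebraicGeometry.Frobenioids.UnitLinearFrobenius
import Literature.AlgebraicGeometry.Frobenioids.UnitWiseFrobeniusHolds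
import Literature.AlgebraicGeometry.Frobenioids.UnitWiseFrobeniusZetaExists
import Literature.AlgebraicGeometry.Frobenioids.CdIsFrobenioid
import HarnessLib

/-!
# Frobenioids II, Example 1.1 (ii) / Remark 1.2.1 at `C^⊢(ℚ_p)`: the Frobenius functors EXIST — non-vacuity of [FrdI] Prop. 2.5 (iii) and Cor. 2.6

Mochizuki, *The geometry of Frobenioids II*, Kyushu J. Math. **62** (2008) 401–460, §1, Remark 1.2.1, p. 10
[cite: MochizukiFrdII2008, Rmk 1.2.1 p.10]:

> "We observe in passing that if `Φ` is absolutely primitive, then by Theorem 1.2, (i), (v), it follows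
> that `C` admits unit-linear Frobenius functors as in [FrdI], Proposition 2.5, (iii) [where one takes the
> 'Λ' of loc. cit. to be `ℤ`], and unit-wise Frobenius functors as in [FrdI], Corollary 2.6. …"

and Mochizuki, *The geometry of Frobenioids I*, Kyushu J. Math. **62** (2008), Prop. 2.5 (iii) p. 49 /
Cor. 2.6 p. 50 [cite: MochizukiFrdI2008, Cor. 2.6 p.50].

PROOF-ONLY companion (abc-iut-w5-d248; RQ7 audit note N3 on p411338/p412055).  The named statements
`PreFrobenioid.UnitLinearFrobeniusExists`, `PreFrobenioid.CdIsFrobenioid`, `PreFrobenioid.UnitWiseFrobeniusExists`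
(abc-iut-L1-t2, `CharacteristicSplitting.lean`) are now THEOREMS (abc-iut-L6-t9: `unitLinearFrobeniusExists`,
`cdIsFrobenioid`, `unitWiseFrobeniusExists`).  Their printed hypotheses — a characteristic splitting `τ`;
`C` a Frobenioid of Frobenius-normalized, metrically trivial and `Aut`-ample type — are JOINTLY INHABITED in the
tree by the concrete absolutely primitive `p`-adic Frobenioid `C^⊢(ℚ_p)` over the one-object base `Spec ℚ_p`
(`PadicFrd.Datum.primQp` with `τ_p = τQp`, abc-iut-L1-t4; [IUTchI] Ex. 3.3's `C_v^⊢` at `K_v = ℚ_p`):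
Ex. 1.1 (ii) `isFrobenioid_of_isMonoidData` + `primQp_isMonoidData`, Frobenius-normalized (every model
Frobenioid, abc-iut-L1-d8), metrically trivial (base-trivial, Thm. 1.2 (v), `primQp_isAbsolutelyPrimitive`),
`Aut`-ample (Thm. 1.2 (i)).  Hence KERNEL NON-VACUITY CERTIFICATES: on `C^⊢(ℚ_p)` the unit-linear Frobenius
functor `Ψ : C ⥲ C(d)` exists, `C(d) → F_{d·Φ}` is a Frobenioid, and the unit-wise Frobenius functor with
(a)–(d) exists, for every `d ∈ ℕ_{≥1}`; and Remark 1.2.1 holds for `C^⊢(ℚ_p)` with NO hypotheses (abc-iut-L1-t4's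
conditional `Datum.rmk121_bindFrobenius` with all seven inputs supplied by tree theorems).  The general
"Remark 1.2.1 unconditional" binding for an arbitrary datum is abc-iut-w5-d214's `PadicFrobenioidRmk121Holds.lean`
(first stamp); this file only instantiates at `C^⊢(ℚ_p)` and adds the `C(d)` clause.
Nothing here is asserted beyond what is proved; no statement of either paper is strengthened.
-/

noncomputable section

namespace Literature.AlgebraicGeometry.Frobenioids

namespace PadicFrd

open CategoryTheory Opposite Function PreFrobenioid

universe v u

namespace Datum

variable {D : Type u} [Category.{v} D] {p : ℕ} [Fact p.Prime] (d : Datum D p)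

/-- For absolutely primitive `Φ` with monoid data, **`C(d)` (with `C(d) → F_{d·Φ}`) is a Frobenioid** for every
`d ∈ ℕ_{≥1}` — the bracket of [FrdI] Prop. 2.5 (iii) (`PreFrobenioid.cdIsFrobenioid`) applied "by Theorem 1.2,
(i), (v)" exactly as Remark 1.2.1 applies Prop. 2.5 (iii): `τ_p` (`pSplitting`), Frobenius-normalized
(model Frobenioid), metrically trivial (base-trivial, Thm. 1.2 (v)), `Aut`-ample (Thm. 1.2 (i)).
[cite: MochizukiFrdII2008, Rmk 1.2.1 p.10] -/
theorem isFrobenioid_cd_of_isAbsolutelyPrimitive (h : d.IsMonoidData) (hap : d.IsAbsolutelyPrimitive)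
    (n : ℕ+) : IsFrobenioid (cdToElem d.structureFunctor (powEnd d.Φ n)) :=
  cdIsFrobenioid n (d.pSplitting hap) (d.isFrobenioid_of_isMonoidData h)
    ModelFrobenioid.isOfType_isFrobeniusNormalized (d.isOfType_isMetricallyTrivial_of_isAbsolutelyPrimitive hap)
    d.thm12_isAutAmple

end Datum

/-! ### The concrete case `C^⊢(ℚ_p)`: Remark 1.2.1 premise-free, and non-vacuity certificates -/

variable (p : ℕ) [Fact p.Prime]

/-- **Remark 1.2.1 for `C^⊢(ℚ_p)`** (the absolutely primitive `p`-adic Frobenioid over the one-object base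
`Spec ℚ_p`, `Datum.primQp`) — NO hypotheses: abc-iut-L1-t4's conditional `Datum.rmk121_bindFrobenius` with its
seven inputs ("`C` is a Frobenioid" Ex. 1.1 (ii); [FrdI] Prop. 2.5 (iii), Cor. 2.6, Prop. 2.9 (ii); isotropic,
pre-model, unit-profinite type, Thm. 1.2 (i)) supplied by tree theorems. [cite: MochizukiFrdII2008, Rmk 1.2.1 p.10] -/
theorem rmk121_primQp (V : Thm12Vocab (Datum.primQp p)) : Rmk121 (Datum.primQp p) V.bindFrobenius :=
  (Datum.primQp p).rmk121_bindFrobenius V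
    ((Datum.primQp p).isFrobenioid_of_isMonoidData (primQp_isMonoidData p))
    (fun n => unitLinearFrobeniusExists n) (fun n => unitWiseFrobeniusExists n)
    (fun ζ => unitWiseFrobeniusZetaExists ζ) (Datum.primQp p).thm12_isOfIsotropicType
    (Datum.primQp p).thm12_isOfPreModelType' (Datum.primQp p).thm12_i_unitProfinite

/-- The three families of Frobenius functors of Remark 1.2.1 EXIST on `C^⊢(ℚ_p)` (the absolute primitivity
premise of `Rmk121` discharged by `primQp_isAbsolutelyPrimitive`). [cite: MochizukiFrdII2008, Rmk 1.2.1 p.10] -/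
theorem admitsFrobeniusFunctors_primQp (V : Thm12Vocab (Datum.primQp p)) :
    (V.bindFrobenius).AdmitsUnitLinearFrobeniusFunctors ∧ (V.bindFrobenius).AdmitsUnitwiseFrobeniusFunctorsI ∧
      (V.bindFrobenius).AdmitsUnitwiseFrobeniusFunctorsII :=
  rmk121_primQp p V (primQp_isAbsolutelyPrimitive p)

/-- NON-VACUITY of [FrdI] Prop. 2.5 (iii) (`UnitLinearFrobeniusExists`): its four printed hypotheses are
jointly inhabited by `(C^⊢(ℚ_p), τ_p)`, so its conclusion holds there — for every `d ∈ ℕ_{≥1}` a unit-linear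
Frobenius functor `Ψ : C^⊢(ℚ_p) ⥲ C^⊢(ℚ_p)(d)` (equivalence, identity on objects and isometries, `1`-compatible
with the Frobenius functor of degree `d` on `F_Φ`). [cite: MochizukiFrdI2008, Prop. 2.5(iii) p.49] -/
theorem unitLinearFrobenius_primQp (n : ℕ+) :
    ∃ U : UnitLinearFrobeniusData (Datum.primQp p).structureFunctor (powEnd (Datum.primQp p).Φ n),
      U.functor.IsEquivalence ∧
        OneCommutes U.functor
          (wideSubcategoryInclusion (divIn (Datum.primQp p).structureFunctor (powEnd (Datum.primQp p).Φ n)) ⋙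
            (Datum.primQp p).structureFunctor)
          (Datum.primQp p).structureFunctor (ElemFrobenioid.frobenius (Datum.primQp p).Φ n) :=
  unitLinearFrobeniusExists n (τQp p)
    ((Datum.primQp p).isFrobenioid_of_isMonoidData (primQp_isMonoidData p))
    ModelFrobenioid.isOfType_isFrobeniusNormalized
    ((Datum.primQp p).isOfType_isMetricallyTrivial_of_isAbsolutelyPrimitive (primQp_isAbsolutelyPrimitive p))
    (Datum.primQp p).thm12_isAutAmple

/-- NON-VACUITY of the bracket of [FrdI] Prop. 2.5 (iii) (`CdIsFrobenioid`): `C^⊢(ℚ_p)(d) → F_{d·Φ}` is a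
Frobenioid for every `d ∈ ℕ_{≥1}`. [cite: MochizukiFrdI2008, Prop. 2.5(iii) p.49] -/
theorem isFrobenioid_cd_primQp (n : ℕ+) :
    IsFrobenioid (cdToElem (Datum.primQp p).structureFunctor (powEnd (Datum.primQp p).Φ n)) :=
  (Datum.primQp p).isFrobenioid_cd_of_isAbsolutelyPrimitive (primQp_isMonoidData p)
    (primQp_isAbsolutelyPrimitive p) n

/-- NON-VACUITY of [FrdI] Cor. 2.6 (`UnitWiseFrobeniusExists`): for every `d ∈ ℕ_{≥1}` a unit-wise Frobenius
functor `Ψ : C^⊢(ℚ_p) → C^⊢(ℚ_p)` with the printed properties (a)–(d) exists — obtained from the landed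
theorem at the characteristic splitting `τ_p`. [cite: MochizukiFrdI2008, Cor. 2.6 p.50] -/
theorem unitWiseFrobenius_primQp (n : ℕ+) :
    ∃ Ψ : CDashQp p ⥤ CDashQp p,
      OneCommutes Ψ (Datum.primQp p).structureFunctor (Datum.primQp p).structureFunctor
          (𝟭 (ElemFrobenioid (Datum.primQp p).Φ)) ∧
      (∀ A : CDashQp p, IsIsotropic (Datum.primQp p).structureFunctor A → Nonempty (Ψ.obj A ≅ A)) ∧
      (∀ {A B : CDashQp p} (φ : A ⟶ B), IsIsotropic (Datum.primQp p).structureFunctor A →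
        IsIsotropic (Datum.primQp p).structureFunctor B →
          (IsFrobeniusType (Datum.primQp p).structureFunctor φ ∨ IsPreStep (Datum.primQp p).structureFunctor φ ∨
            IsPullbackMorphism (Datum.primQp p).structureFunctor φ) →
            IsAbstractlyEquivalent (Ψ.map φ) φ) ∧
      (∀ A : CDashQp p, IsIsotropic (Datum.primQp p).structureFunctor A → ∃ e : Ψ.obj A ≅ A,
        ∀ u ∈ unitsSubgroup (Datum.primQp p).structureFunctor A,
          e.inv ≫ Ψ.map u.hom ≫ e.hom = (u ^ (n : ℕ)).hom) ∧
      (IsOfPerfectType (Datum.primQp p).structureFunctor → Ψ.IsEquivalence) ∧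
      ((n = 1 ∨ (IsOfIsotropicType (Datum.primQp p).structureFunctor ∧
          IsOfType (IsUnitTrivial (Datum.primQp p).structureFunctor))) → Nonempty (Ψ ≅ 𝟭 (CDashQp p))) :=
  unitWiseFrobeniusExists n (τQp p)
    ((Datum.primQp p).isFrobenioid_of_isMonoidData (primQp_isMonoidData p))
    ModelFrobenioid.isOfType_isFrobeniusNormalized
    ((Datum.primQp p).isOfType_isMetricallyTrivial_of_isAbsolutelyPrimitive (primQp_isAbsolutelyPrimitive p))
    (Datum.primQp p).thm12_isAutAmple

end PadicFrd

end Literature.AlgebraicGeometry.Frobenioids
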